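import Summits.ABC.IUTFork.Conditional.AbcOfSHvolRefutation
import Summits.ABC.IUTFork.Conditional.AbcOfSlackRegimeSzpiro
import Summits.ABC.IUTFork.Conditional.AbcOfSlackRegime
import Summits.ABC.IUTFork.Conditional.AbcOfSHvolSzpiroSuff
import Summits.ABC.IUTFork.LDHGenuineHullRegimeMixedPoint
import HarnessLib

/-!
# Branch C, TARGET #1: after `not_hvol_v3` (p453135) every Szpiro-TRADE cone binder of record is FALSE AS TYPED — `hSz`, `hMix`
# (abc-iut-s2-p1), `hres`, `hresSz` (abc-iut-s2-p10) — by one `mt` each (abc-iut cell, R2 S-chain team seat abc-iut-s2-p1 gen 3,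
# «TRADE-BINDERS-VACATED»; certificates `AbcOfStatementGenuineKCuts` p447155 / `…MCuts` p444732, `AbcOfSlackRegime(Szpiro)`, `AbcOfSHvolSzpiroSuff`)

Record-only PROOF file (D-0012) of the abc-iut cell; TAKES NO SIDE on [IUTchIII] Cor. 3.12, on [IUTchIV] Thm. 1.10 or on any author.
S. Mochizuki, *IUT IV* [Mochizuki2012], Thm. 1.10 proof Steps (ii)–(viii) pp. 24–30; Cor. 2.2 (ii) proof pp. 44–46.
[claim: Mochizuki2012, status: disputed] for every IUT quotation; the content of THIS file is four contrapositions of landed cell theorems.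

THE BOOKKEEPING. Each trade binder `hX` of the s2 SCOREBOARD was landed together with a SUFFICIENCY theorem `hX ⟹ hvol` (conclusion = the CONE
binder `hvol` of `Conditional.abc_of_S_v3`, p430884 l. 375–381, VERBATIM): abc-iut-s2-p1's `Conditional.hvol_of_szpiroSuff` (p435048, TRADE 2,
the datum-free Szpiro-type inequality with `π`-slack at `d_mod ≥ 2`) and `Conditional.hvol_of_pointMixedSzpiro` (p438083, the datum-free
mixed-height Szpiro-type bound), abc-iut-s2-p10's `Conditional.hullVolume_of_slackRegime` (p434025, TRADE 1, the residue cut) and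
`Conditional.hullVolume_of_szpiroSlackRegime` (p436259, the Szpiro-slack residue cut). abc-iut-s2-p5's `Conditional.not_hvol_v3` (p453135: the
explicit admissible degree-2 family `P_k = (ℚ(√2), 1/2 + 2/(3+√2)^k)` with the (P1)-window prime of abc-iut-s2-p3 violates abc-iut-s2-p1's sharp
datum-free necessity p446116) refutes that common conclusion; `mt` transports the refutation to each antecedent. Statements below are the
binders VERBATIM (the hypothesis texts of the four sufficiency theorems = the `hSz` / `hMix` / `hresSz` binders of abc-iut-s2-p10's
`abc_of_cor312Statement_genuineK_szpiroSuff` / `…_pointMixedSzpiro` / `…_szpiroSlack`, p447155, and their M twins p444732).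

* **`Conditional.not_hSz`** — `¬ hSz`; * **`Conditional.not_hMix`** — `¬ hMix`; * **`Conditional.not_hres`** — `¬ hres`; * **`Conditional.not_hresSz`** — `¬ hresSz`.

READING (for the planners; numbers, not a side). With p453135 these four datum-free / residue-cut Szpiro-type ∀-binders join `hvol`, `hreg`
and `hSH` as kernel-false AS TYPED at explicit admissible `d_mod = 2` data; the certificates carrying them are composition records in that binder.
What is NOT refuted here and stays typed-open: the Szpiro-BAD-guarded binders (`hregBad`, `haboveBad`, abc-iut-s2-p2 p452755 / RESHAPE-4;
Szpiro-badness of `P_k` is undecided in the kernel at symbolic `k`), the mixing-locus squeeze `hSqMix` (abc-iut-C-cert-2, β), and every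
THEOREM: the `d_mod = 1` / slot-constant / equal-heights cuts, the additive forms `Conditional.hvolMix_holds` / `PointDict.hullVolumeAtDatum_BIII_add_pointMixedHeight`
(p454530 / p455026) and the binder-free squeeze minus the mixed share `Conditional.squeezeMix_of_cor312At`. HONEST SCOPE: four one-line
contrapositions; nothing asserted about print; no side taken; typed ≠ proved; refuted-as-typed ≠ refuted-in-print.
[cite: Mochizuki2012, IUTchIV Thm. 1.10 proof Steps (ii)–(viii) p. 24–30] [cite: Mochizuki2012, IUTchIV Cor. 2.2 (ii) proof p. 44–46]
-/

noncomputable section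

namespace Summit.ABC.IUTFork.Conditional

open NumberField IsDedekindDomain Literature.IUT.LogVolume Literature.IUT.HodgeTheaters
open Literature.NumberTheory.DiophantineGeometry.GenEll
open scoped Classical

/-- **`¬ hSz` — abc-iut-s2-p1's DATUM-FREE SZPIRO-TYPE TRADE BINDER (TRADE 2 of the s2 SCOREBOARD, `π`-slack form at `d_mod ≥ 2`) is FALSE
AS TYPED**: the hypothesis of `Conditional.hvol_of_szpiroSuff` (p435048) = the `hSz` binder of abc-iut-s2-p10's
`abc_of_cor312Statement_genuineK_szpiroSuff` (p447155), VERBATIM, negated — `mt hvol_of_szpiroSuff not_hvol_v3`. The slack-free form was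
refuted directly by abc-iut-s2-p5's `QuadWitness.not_szpiroPure` (p442698); the `π`-slack form falls with `hvol`.
[cite: Mochizuki2012, IUTchIV Thm. 1.10 proof Steps (ii)–(viii) p. 24–30] [claim: Mochizuki2012, status: disputed] -/
theorem not_hSz :
    ¬ (∀ P : NFPoint, P ∈ UP → ∀ l : ℕ, l.Prime → 5 ≤ l →
      Cor22.AdmitsCore P → Cor22.CondP2 P l → Cor22.CondP5 P l → Cor22.CondP6 P l → 2 ≤ Cor22.dmod P →
      Cor22.logQAvoid P {2, l} ≤
        24 * ((Cor22.dmod P : ℝ) - 1) / l * (P.logDiff + Cor22.logCondAvoid P {2, l})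
        + 40 * Real.log (((2 ^ 12 * 3 ^ 3 * 5 * Cor22.dmod P : ℕ) : ℝ) * l)
          * max 0 (((Nat.primeCounting (2 ^ 12 * 3 ^ 3 * 5 * Cor22.dmod P * l) : ℝ)
            - (2 * (Cor22.dmod P : ℝ) * (P.logDiff + Cor22.logCondAvoid P {2, l}) + Real.log (2 * 3 * 5 * (l : ℝ)))
              / Real.log 2))) :=
  mt hvol_of_szpiroSuff not_hvol_v3

/-- **`¬ hMix` — abc-iut-s2-p1's DATUM-FREE MIXED-HEIGHT SZPIRO-TYPE TRADE BINDER is FALSE AS TYPED**: the hypothesis of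
`Conditional.hvol_of_pointMixedSzpiro` (p438083) = the `hMix` binder of abc-iut-s2-p10's `abc_of_cor312Statement_genuineK_pointMixedSzpiro`
(p447155), VERBATIM, negated — `mt hvol_of_pointMixedSzpiro not_hvol_v3`. (At abc-iut-s2-p5's family `H_mix ⊇ S₇ = k·log 7` exceeds every
`O(k^{1/2} log k)` slack; the ADDITIVE form `hvolMix_holds`, p455026, is the theorem that survives.)
[cite: Mochizuki2012, IUTchIV Thm. 1.10 proof Steps (ii)–(viii) p. 24–30] [cite: DupuyHilado2025, §3.3, §3.6, §4.7] [claim: Mochizuki2012, status: disputed] -/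
theorem not_hMix :
    ¬ (∀ P : NFPoint, P ∈ UP → ∀ l : ℕ, l.Prime → 5 ≤ l →
      Cor22.AdmitsCore P → Cor22.CondP2 P l → Cor22.CondP5 P l → Cor22.CondP6 P l →
      ∃ M : Finset ℕ,
        (∀ p : ℕ, p.Prime →
          (¬ ∀ V W : HeightOneSpectrum (𝓞 ↥(IntermediateField.adjoin ℚ ({Cor22.jInv P.x} : Set P.F))),
            V ∈ placesOver _ p → W ∈ placesOver _ p →
            (if ord _ V (Cor22.jMod P) < 0 ∧ ((2 : ℕ) : 𝓞 _) ∉ V.asIdeal ∧ ((l : ℕ) : 𝓞 _) ∉ V.asIdeal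
              then ((-ord _ V (Cor22.jMod P) : ℤ) : ℝ) * logNorm _ V / (localDegree _ V : ℝ) else 0) =
            (if ord _ W (Cor22.jMod P) < 0 ∧ ((2 : ℕ) : 𝓞 _) ∉ W.asIdeal ∧ ((l : ℕ) : 𝓞 _) ∉ W.asIdeal
              then ((-ord _ W (Cor22.jMod P) : ℤ) : ℝ) * logNorm _ W / (localDegree _ W : ℝ) else 0)) → p ∈ M) ∧
        ((l : ℝ) + 1) / 24 *
            ∑ p ∈ M, ∑ V : placesOver ↥(IntermediateField.adjoin ℚ ({Cor22.jInv P.x} : Set P.F)) p,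
              (if ord _ V.1 (Cor22.jMod P) < 0 ∧ ((2 : ℕ) : 𝓞 _) ∉ V.1.asIdeal ∧ ((l : ℕ) : 𝓞 _) ∉ V.1.asIdeal then
                weight _ V.1 * (((-ord _ V.1 (Cor22.jMod P) : ℤ) : ℝ) * logNorm _ V.1 / (localDegree _ V.1 : ℝ))
               else 0) ≤
          ((l : ℝ) + 1) / 4 * (4 * ((Cor22.dmod P : ℝ) - 1) / l * (P.logDiff + Cor22.logCondAvoid P {2, l})
            + 20 / 3 * Real.log (((2 ^ 12 * 3 ^ 3 * 5 * Cor22.dmod P : ℕ) : ℝ) * l)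
              * max 0 (((Nat.primeCounting (2 ^ 12 * 3 ^ 3 * 5 * Cor22.dmod P * l) : ℝ)
                - (2 * (Cor22.dmod P : ℝ) * (P.logDiff + Cor22.logCondAvoid P {2, l}) + Real.log (2 * 3 * 5 * (l : ℝ)))
                  / Real.log 2)))) :=
  mt hvol_of_pointMixedSzpiro not_hvol_v3

/-- **`¬ hres` — abc-iut-s2-p10's RESIDUE-CUT TRADE BINDER (TRADE 1 of the s2 SCOREBOARD) is FALSE AS TYPED**: the hypothesis of
`Conditional.hullVolume_of_slackRegime` (p434025: the (U)-hull estimate with `B_III` demanded only at `2 ≤ d_mod`, height above abc-iut-c312-d1's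
`π`-threshold, non-slot-constant data whose slot residue exceeds the Step-(viii) slack), VERBATIM, negated — `mt hullVolume_of_slackRegime
not_hvol_v3`. [cite: Mochizuki2012, IUTchIV Thm. 1.10 proof Steps (v), (viii) p. 27–31] [claim: Mochizuki2012, status: disputed] -/
theorem not_hres :
    ¬ (∀ P : NFPoint, P ∈ UP → ∀ l : ℕ, l.Prime → 5 ≤ l →
      Cor22.AdmitsCore P → Cor22.CondP2 P l → Cor22.CondP5 P l → Cor22.CondP6 P l →
      2 ≤ Cor22.dmod P →
      40 * Real.log (((2 ^ 12 * 3 ^ 3 * 5 * Cor22.dmod P : ℕ) : ℝ) * l)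
        * ((Nat.primeCounting (2 ^ 12 * 3 ^ 3 * 5 * Cor22.dmod P * l) : ℝ)
          - (2 * (Cor22.dmod P : ℝ) * (P.logDiff + Cor22.logCondAvoid P {2, l}) + Real.log (2 * 3 * 5 * (l : ℝ)))
            / Real.log 2) < Cor22.logQAvoid P {2, l} →
      ∀ T : Cor22.ThetaVolumeDatumAt P l,
        (letI := T.instFieldF; letI := T.instNumberFieldF; letI := T.instAlgebraF; letI := T.instFieldK
         letI := T.instNumberFieldK; letI := T.instAlgebraK; letI := T.instFieldFbar; letI := T.instAlgebraFbar
         letI := T.instAlgebraKFbar; letI := T.instIsElliptic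
         ¬ (∀ p ∈ T.I.supportPrimes, ∀ v w : placesOver (fieldOfModuli T.E) p,
            (Summit.ABC.IUTFork.DHData.ofInput T.I).logQloc p v = (Summit.ABC.IUTFork.DHData.ofInput T.I).logQloc p w)) →
        (letI := T.instFieldF; letI := T.instNumberFieldF; letI := T.instFieldK; letI := T.instNumberFieldK
         letI := T.instAlgebraK
         ((l : ℝ) + 1) / 4 * (20 / 3 * Real.log (((2 ^ 12 * 3 ^ 3 * 5 * Cor22.dmod P : ℕ) : ℝ) * l)
            * ((Nat.primeCounting (2 ^ 12 * 3 ^ 3 * 5 * Cor22.dmod P * l) : ℝ)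
              - ((T.I.supportPrimes.filter (· ≤ 2 ^ 12 * 3 ^ 3 * 5 * Cor22.dmod P * l)).card : ℝ))) <
           T.I.X.slotResidue T.I.supportPrimes) →
        T.HullEstimateOf
          (((l : ℝ) + 1) / 4 *
            ((1 + 12 * (Cor22.dmod P : ℝ) / l) * (P.logDiff + Cor22.logCondAvoid P {2, l})
              + 2 * Real.log l + 52
              + 20 / 3 * Real.log (((2 ^ 12 * 3 ^ 3 * 5 * Cor22.dmod P : ℕ) : ℝ) * (l : ℝ))
                * (Nat.primeCounting (2 ^ 12 * 3 ^ 3 * 5 * Cor22.dmod P * l) : ℝ)))) :=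
  mt hullVolume_of_slackRegime not_hvol_v3

/-- **`¬ hresSz` — abc-iut-s2-p10's SZPIRO-SLACK RESIDUE-CUT TRADE BINDER is FALSE AS TYPED**: the hypothesis of
`Conditional.hullVolume_of_szpiroSlackRegime` (p436259) = the `hresSz` binder of `abc_of_cor312Statement_genuineK_szpiroSlack` (p447155) and of
abc-iut-C-cert-2's `abc_of_SH_v7K_szpiroSlack` (p440821), VERBATIM, negated — `mt hullVolume_of_szpiroSlackRegime not_hvol_v3`. The strongest landed
cut (`hreg ⟹ habove ⟹ hresSz`), hence its negation is the strongest of the four.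
[cite: Mochizuki2012, IUTchIV Thm. 1.10 proof Steps (ii)–(viii) p. 24–31] [claim: Mochizuki2012, status: disputed] -/
theorem not_hresSz :
    ¬ (∀ P : NFPoint, P ∈ UP → ∀ l : ℕ, l.Prime → 5 ≤ l →
      Cor22.AdmitsCore P → Cor22.CondP2 P l → Cor22.CondP5 P l → Cor22.CondP6 P l →
      2 ≤ Cor22.dmod P →
      40 * Real.log (((2 ^ 12 * 3 ^ 3 * 5 * Cor22.dmod P : ℕ) : ℝ) * l)
        * ((Nat.primeCounting (2 ^ 12 * 3 ^ 3 * 5 * Cor22.dmod P * l) : ℝ)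
          - (2 * (Cor22.dmod P : ℝ) * (P.logDiff + Cor22.logCondAvoid P {2, l}) + Real.log (2 * 3 * 5 * (l : ℝ)))
            / Real.log 2) < Cor22.logQAvoid P {2, l} →
      ∀ T : Cor22.ThetaVolumeDatumAt P l,
        (letI := T.instFieldF; letI := T.instNumberFieldF; letI := T.instAlgebraF; letI := T.instFieldK
         letI := T.instNumberFieldK; letI := T.instAlgebraK; letI := T.instFieldFbar; letI := T.instAlgebraFbar
         letI := T.instAlgebraKFbar; letI := T.instIsElliptic
         ¬ (∀ p ∈ T.I.supportPrimes, ∀ v w : placesOver (fieldOfModuli T.E) p,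
            (Summit.ABC.IUTFork.DHData.ofInput T.I).logQloc p v = (Summit.ABC.IUTFork.DHData.ofInput T.I).logQloc p w)) →
        (letI := T.instFieldF; letI := T.instNumberFieldF; letI := T.instFieldK; letI := T.instNumberFieldK
         letI := T.instAlgebraK
         ((l : ℝ) + 1) / 4 * (4 * ((Cor22.dmod P : ℝ) - 1) / l * (P.logDiff + Cor22.logCondAvoid P {2, l})
            + 20 / 3 * Real.log (((2 ^ 12 * 3 ^ 3 * 5 * Cor22.dmod P : ℕ) : ℝ) * l)
              * ((Nat.primeCounting (2 ^ 12 * 3 ^ 3 * 5 * Cor22.dmod P * l) : ℝ)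
                - ((T.I.supportPrimes.filter (· ≤ 2 ^ 12 * 3 ^ 3 * 5 * Cor22.dmod P * l)).card : ℝ))) <
           T.I.X.slotResidue T.I.supportPrimes) →
        T.HullEstimateOf
          (((l : ℝ) + 1) / 4 *
            ((1 + 12 * (Cor22.dmod P : ℝ) / l) * (P.logDiff + Cor22.logCondAvoid P {2, l})
              + 2 * Real.log l + 52
              + 20 / 3 * Real.log (((2 ^ 12 * 3 ^ 3 * 5 * Cor22.dmod P : ℕ) : ℝ) * (l : ℝ))
                * (Nat.primeCounting (2 ^ 12 * 3 ^ 3 * 5 * Cor22.dmod P * l) : ℝ)))) :=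
  mt hullVolume_of_szpiroSlackRegime not_hvol_v3

end Summit.ABC.IUTFork.Conditional

end
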